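import Literature.MathematicalPhysics.QuantumFieldTheory.Balaban1983to89.T4QuatExpLog
import Mathlib.Analysis.SpecialFunctions.Trigonometric.Cotangent
import Mathlib.Analysis.Convex.Jensen
import HarnessLib

/-!
# T4EMLFibreAC — the fibre law of the exp-mean-log average on `SU(2)` has injective tangent differential; absolute
# continuity of the restricted Haar push-forward (pub-balaban, row T4-D.G-EML-K3-FIBRE*, leaf B)

Pure calculus / convexity / measure theory over Mathlib and leaf A (`T4QuatExpLog`); no Bałaban content, every declaration is
[folklore].  PURPOSE ONLY (no journal text is typed here): this is certificate (E1)–(E4) + kernel row (K3) of the cell record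
`HOME/b2b-balaban-pv03/EML-HAARAC.md` (§3, §5), i.e. the map-specific input which, fed to the map-independent engine
`T4HaarSU2LocalDiffeo.haar_restrict_map_absolutelyContinuous` ((K4), landed), gives absolute continuity of the ONE-VARIABLE LAW of the
PRINTED exp-mean-log small-loop average of [Balaban1987RG1] (0.4) p. 253 on `SU(2)` — the input the (K4) assembler needs toward the OPEN
off-spine node `T4ApexTwoLevel.BlockHaarAC F ExpMeanLog.expMeanLogSU`.  In the private bond variable `W`, with the other bonds frozen, that
law is `W ↦ exp(Σ_i c_i log(h_i W*)) W` with unit `h_i`, weights `c_i ≥ 0`, `Σ_i c_i = s < 1`; in the quaternion model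
(`u = su2Quat W`, `a_i = su2Quat h_i`) it is the FIBRE MAP `k(u) = exp(Σ_i c_i • qlog(a_i ū)) · u` of §4.

THE ARGUMENT (why `k′(u)` is injective on `u^⊥`, §4).  Write a tangent vector as `v = u x` (`x` imaginary), `X = u x ū`,
`W_i = a_i ū`, `Z_i = qlog W_i` (imaginary, `‖Z_i‖ < 1`), `Y = Σ c_i Z_i`.  By leaf A, `D qlog(W_i)(W_i X) = N_{Z_i} X` and
`D exp(Y)(N_Y X) = e^Y X`, so `k′(u) v = D exp(Y) (N_Y X − Σ_i c_i N_{Z_i} X) · u`; `D exp(Y)` is injective (`‖Y‖ < 1 < π`), hence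
`k′(u) v = 0` gives `N_Y X = Σ_i c_i N_{Z_i} X`, and pairing with `X` (leaf A: `⟪N_w X, X⟫ = ‖X‖² − G_w(X)`,
`G_w(X) = ψ(‖w‖) ‖X_⊥‖²`, `ψ(θ) = 1 − θ cot θ`) yields `(1 − s) ‖X‖² = G_Y(X) − Σ_i c_i G_{Z_i}(X)`.  The right-hand side is `≤ 0`
by JENSEN, because `w ↦ G_w(X)` is CONVEX on the imaginary ball of radius `π` and vanishes at `0` (§3); so `X = 0`, `v = 0`.
Convexity is proved termwise from the MITTAG-LEFFLER expansion `1 − θ cot θ = Σ_{n≥0} 2θ²/((n+1)²π² − θ²)` (§1, from Mathlib's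
`cot_series_rep'`): `G_w(X) = Σ_n 2‖A_X w‖²/((n+1)²π² − ‖w‖²)` with `A_X` LINEAR in `w` (§2), and each term `‖A w‖²/(R − ‖w‖²)` is
convex on `‖w‖² < R` by the two-point (Engel) form of Cauchy–Schwarz (§3).  No smallness of `s` is used — only `s < 1` and the
guard `‖h_i W* − 1‖ < 1/2` (so that the series logarithm applies and `‖Z_i‖ < 1`).

CONTENT.
* §1 `hasSum_ψ` — Mittag-Leffler for `ψ(θ) = 1 − θ cot θ`, `0 < θ < π`.
* §2 `G`, `Aop`, `hasSum_G` — the defect form and its Mittag-Leffler form.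
* §3 `convex_imBall`, `norm_sq_combo_div_le` (two-point inequality), `convexOn_G`, `sum_smul_mem_imBall`, `G_sum_le` (Jensen, weights
  of total mass `≤ 1`, padded with the point `0`).
* §4 `Yf`, `kf`, `YD`, `kD`, `hasStrictFDerivAt_kf` (strict derivative `kD` on the guard domain), `kD_tangent_injective` (MAIN LEMMA).
* §5 `haar_restrict_map_absolutelyContinuous_expMeanLog` (+ `haarData_…`) — MATRIX COROLLARY on `SU(2)`: `S` open, `h_i ∈ SU(2)`,
  `c_i ≥ 0`, `Σ c_i < 1`, `K` measurable with `‖h_i W* − 1‖ < 1/2` and `↑(K W) = exp(Σ_i (c_i : ℂ) • mlog(h_i W*)) · W` on `S`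
  ⟹ `((Haar).restrict S).map K ≪ Haar`.

VALUE = kernel calculus/measure theory for a named open node (its (K4) assembly input); NOT an estimate of the papers, NOT summit progress.

v1.1 (DELTA, statements generalised, proofs unchanged): the loop index of §3–§5 is an arbitrary `Fintype ι` (v1: `Fin m`), matching
the index of the tree's `ExpMeanLog.eml`/`expMeanLogSU`, so the (K4) assembler instantiates `h : ι → SU(2)`, `c : ι → ℝ` without
reindexing; every v1 call elaborates unchanged (`ι := Fin m` is inferred from `h`).
-/

noncomputable section

open NormedSpace Set Metric Function Filter MeasureTheory
open scoped RealInnerProductSpace Topology Quaternion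

namespace Literature.MathematicalPhysics.QuantumFieldTheory.Balaban1983to89.T4EMLFibreAC

open Literature.MathematicalPhysics.QuantumLattice (quatMatrix quatMatrix_mul quatMatrix_one quatMatrix_smul quatMatrix_neg
  su2Quat norm_su2Quat quatToSU2 coe_quatToSU2_of_norm_eq_one quatToSU2_su2Quat quatMatrix_su2Quat)
open Literature.Geometry.GaugeTheory (quatMatrix_add quatMatrix_zero quatMatrix_star)
open T4HaarSU2LocalDiffeo (topRowQuat topRowQuat_quatMatrix topRowQuat_coe quatMatrixCLM quatMatrixCLM_apply
  haar_restrict_map_absolutelyContinuous)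
open T4HaarSU2Translate (su2Quat_quatToSU2 quatMatrix_sum su2Quat_eq_of_coe_eq)
open T4QuatExpLog

/-! ## 1. The Mittag-Leffler expansion of `ψ(θ) = 1 − θ cot θ` -/

section MittagLeffler

open Complex in
/-- `θ/π` is not an integer for `0 < θ < π`. [folklore] -/
theorem div_pi_mem_integerComplement {θ : ℝ} (h0 : 0 < θ) (hπ : θ < Real.pi) :
    ((θ / Real.pi : ℝ) : ℂ) ∈ Complex.integerComplement := by
  rw [Complex.mem_integerComplement_iff]
  rintro ⟨n, hn⟩
  have hn' : (n : ℝ) = θ / Real.pi := by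
    have := congrArg Complex.re hn
    simpa using this
  have h1 : (0 : ℝ) < n := by rw [hn']; positivity
  have h2 : (n : ℝ) < 1 := by rw [hn', div_lt_one Real.pi_pos]; exact hπ
  have h1' : (0 : ℤ) < n := by exact_mod_cast h1
  have h2' : n < (1 : ℤ) := by exact_mod_cast h2
  omega

/-- MITTAG-LEFFLER FOR `1 − θ cot θ`: `ψ(θ) = Σ_{n ≥ 0} 2θ² / ((n+1)²π² − θ²)` for `0 < θ < π` (Mathlib's `cot_series_rep'`
at `x = θ/π`, real parts). [folklore] -/
theorem hasSum_ψ {θ : ℝ} (h0 : 0 < θ) (hπ : θ < Real.pi) :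
    HasSum (fun n : ℕ => 2 * θ ^ 2 / (((n : ℝ) + 1) ^ 2 * Real.pi ^ 2 - θ ^ 2)) (ψ θ) := by
  have hpi := Real.pi_pos
  set x : ℝ := θ / Real.pi with hx_def
  have hx0 : x ≠ 0 := (div_pos h0 hpi).ne'
  have hxC := div_pi_mem_integerComplement h0 hπ
  -- the complex series and its sum
  have hsumC : HasSum (fun n : ℕ => cotTerm (x : ℂ) n) (Real.pi * Complex.cot (Real.pi * x) - 1 / x) := by
    rw [cot_series_rep' hxC]
    exact (summable_cotTerm hxC).hasSum
  -- denominators do not vanish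
  have hden : ∀ n : ℕ, ((n : ℝ) + 1) ^ 2 * Real.pi ^ 2 - θ ^ 2 ≠ 0 := by
    intro n
    have h1 : θ ^ 2 < Real.pi ^ 2 := by nlinarith
    have h2 : Real.pi ^ 2 ≤ ((n : ℝ) + 1) ^ 2 * Real.pi ^ 2 := by
      have : (1 : ℝ) ≤ ((n : ℝ) + 1) ^ 2 := by nlinarith [(Nat.cast_nonneg n : (0 : ℝ) ≤ n)]
      nlinarith
    linarith
  have hden' : ∀ n : ℕ, x ^ 2 - ((n : ℝ) + 1) ^ 2 ≠ 0 := by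
    intro n h
    apply hden n
    have : x ^ 2 * Real.pi ^ 2 = θ ^ 2 := by rw [hx_def, div_pow, div_mul_cancel₀ _ (pow_ne_zero 2 hpi.ne')]
    nlinarith [this, h]
  -- the terms are real
  have hterm : ∀ n : ℕ, cotTerm (x : ℂ) n = ((2 * x / (x ^ 2 - ((n : ℝ) + 1) ^ 2) : ℝ) : ℂ) := by
    intro n
    have h1 : (x : ℂ) - (n + 1) ≠ 0 := by
      have := hden' n
      intro h
      have hre := congrArg Complex.re h
      simp at hre
      apply this
      nlinarith [hre]
    have h2 : (x : ℂ) + (n + 1) ≠ 0 := by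
      intro h
      have hre := congrArg Complex.re h
      simp at hre
      have : (0 : ℝ) < x := div_pos h0 hpi
      linarith [(Nat.cast_nonneg n : (0 : ℝ) ≤ n)]
    rw [cotTerm, div_add_div _ _ h1 h2]
    push_cast
    have h3 : ((x : ℂ) ^ 2 - ((n : ℂ) + 1) ^ 2) ≠ 0 := by
      rw [sq_sub_sq]; exact mul_ne_zero h2 h1
    field_simp
    ring
  -- the sum is real: `π cot θ − π/θ`
  have hval : Real.pi * Complex.cot (Real.pi * x) - 1 / x = ((Real.pi * Real.cot θ - Real.pi / θ : ℝ) : ℂ) := by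
    have hθ : Real.pi * x = θ := by rw [hx_def, mul_div_cancel₀ _ hpi.ne']
    have hθC : (θ : ℂ) ≠ 0 := by exact_mod_cast h0.ne'
    have hπC : (Real.pi : ℂ) ≠ 0 := by exact_mod_cast hpi.ne'
    have h1x : (1 : ℂ) / (x : ℂ) = (Real.pi : ℂ) / (θ : ℂ) := by
      rw [hx_def]; push_cast; field_simp
    push_cast
    rw [← Complex.ofReal_mul, hθ, h1x]
  rw [funext hterm, hval] at hsumC
  have hsumR := Complex.hasSum_ofReal.1 hsumC
  -- multiply by `−x` and identify
  have hx2 : x ^ 2 * Real.pi ^ 2 = θ ^ 2 := by rw [hx_def, div_pow, div_mul_cancel₀ _ (pow_ne_zero 2 hpi.ne')]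
  have hψ : ψ θ = -x * (Real.pi * Real.cot θ - Real.pi / θ) := by
    have hsin : Real.sin θ ≠ 0 := (Real.sin_pos_of_pos_of_lt_pi h0 hπ).ne'
    have hθ0 : θ ≠ 0 := h0.ne'
    have hπ0 : Real.pi ≠ 0 := hpi.ne'
    rw [ψ_of_ne_zero hθ0, Real.cot_eq_cos_div_sin, hx_def]
    field_simp
    ring
  rw [hψ]
  refine (hsumR.mul_left (-x)).congr_fun fun n => ?_
  rw [← mul_div_assoc, div_eq_div_iff (hden n) (hden' n), ← hx2]
  ring

end MittagLeffler

/-! ## 2. The defect form `G_w(x) = ψ(‖w‖) ‖perp_w x‖²` and its Mittag-Leffler form -/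

section Defect

variable {w x : ℍ}

/-- The DEFECT FORM `G_w(x) := ψ(‖w‖) ‖perp_w x‖²`, so that `⟪N_w x, x⟫ = ‖x‖² − G_w(x)` (`T4QuatExpLog.inner_N_self`). [folklore] -/
def G (w x : ℍ) : ℝ := ψ ‖w‖ * ‖perp w x‖ ^ 2

/-- `G_0 = 0`. [folklore] -/
@[simp] theorem G_zero_left (x : ℍ) : G 0 x = 0 := by simp [G]

/-- `⟪N_w x, x⟫ = ‖x‖² − G_w(x)` for imaginary `w, x`. [folklore] -/
theorem inner_N_self_eq (hw : w.re = 0) (hx : x.re = 0) : ⟪N w x, x⟫ = ‖x‖ ^ 2 - G w x :=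
  inner_N_self hw hx

/-- The real-linear map `A_x : w ↦ w x + ⟪w, x⟫` (`= w · perp_w x` for imaginary `w`, `T4QuatExpLog.mul_perp`). [folklore] -/
def Aop (x : ℍ) : ℍ →ₗ[ℝ] ℍ where
  toFun w := w * x + ((⟪w, x⟫ : ℝ) : ℍ)
  map_add' w₁ w₂ := by
    simp only [add_mul, inner_add_left, Quaternion.coe_add]; abel
  map_smul' r w := by
    simp only [smul_mul_assoc, real_inner_smul_left, Quaternion.coe_mul, Quaternion.coe_mul_eq_smul, smul_add,
      RingHom.id_apply]

/-- Evaluation of `A_x`. [folklore] -/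
theorem Aop_apply (x w : ℍ) : Aop x w = w * x + ((⟪w, x⟫ : ℝ) : ℍ) := rfl

/-- `A_x w = w · perp_w x` for imaginary `w`. [folklore] -/
theorem Aop_eq_mul_perp (hw : w.re = 0) (x : ℍ) : Aop x w = w * perp w x := by
  rw [Aop_apply, mul_perp hw]

/-- `‖A_x w‖² = ‖w‖² ‖perp_w x‖²` for imaginary `w`. [folklore] -/
theorem norm_Aop_sq (hw : w.re = 0) (x : ℍ) : ‖Aop x w‖ ^ 2 = ‖w‖ ^ 2 * ‖perp w x‖ ^ 2 := by
  rw [Aop_eq_mul_perp hw, norm_mul, mul_pow]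

/-- MITTAG-LEFFLER FORM OF THE DEFECT: `G_w(x) = Σ_{n ≥ 0} 2 ‖A_x w‖² / ((n+1)²π² − ‖w‖²)` for imaginary `w` with `‖w‖ < π`
(each term a squared linear map of `w` over a positive concave denominator — the source of convexity). [folklore] -/
theorem hasSum_G (hw : w.re = 0) (hπ : ‖w‖ < Real.pi) (x : ℍ) :
    HasSum (fun n : ℕ => 2 * ‖Aop x w‖ ^ 2 / (((n : ℝ) + 1) ^ 2 * Real.pi ^ 2 - ‖w‖ ^ 2)) (G w x) := by
  rcases eq_or_ne w 0 with rfl | hw0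
  · simp [G]
  · have h := (hasSum_ψ (norm_pos_iff.2 hw0) hπ).mul_right (‖perp w x‖ ^ 2)
    refine h.congr_fun fun n => ?_
    rw [norm_Aop_sq hw]
    ring

end Defect

/-! ## 3. Convexity of `w ↦ G_w(x)` on the imaginary ball of radius `π` -/

section Convexity

/-- The domain: imaginary quaternions of norm `< π`. [folklore] -/
def imBall : Set ℍ := {w | w.re = 0 ∧ ‖w‖ < Real.pi}

/-- Membership in `imBall`. [folklore] -/
theorem mem_imBall {w : ℍ} : w ∈ imBall ↔ w.re = 0 ∧ ‖w‖ < Real.pi := Iff.rfl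

/-- `0 ∈ imBall`. [folklore] -/
theorem zero_mem_imBall : (0 : ℍ) ∈ imBall := ⟨rfl, by simpa using Real.pi_pos⟩

/-- `imBall` is convex. [folklore] -/
theorem convex_imBall : Convex ℝ imBall := by
  have h1 : Convex ℝ {w : ℍ | w.re = 0} := by
    intro u hu v hv a b _ _ _
    simp only [Set.mem_setOf_eq] at hu hv ⊢
    simp [hu, hv]
  have h2 : imBall = {w : ℍ | w.re = 0} ∩ Metric.ball 0 Real.pi := by
    ext w; simp [imBall]
  rw [h2]
  exact h1.inter (convex_ball 0 Real.pi)

/-- THE TWO-POINT INEQUALITY (Engel form of Cauchy–Schwarz): for `a, b ≥ 0`, `t_u, t_v > 0` and `T ≥ a t_u + b t_v > 0`,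
`‖a p + b q‖² / T ≤ a ‖p‖²/t_u + b ‖q‖²/t_v`; the slack is `(ab/(t_u t_v)) ‖t_v p − t_u q‖²`. [folklore] -/
theorem norm_sq_combo_div_le (p q : ℍ) {a b tu tv T : ℝ} (ha : 0 ≤ a) (hb : 0 ≤ b) (htu : 0 < tu) (htv : 0 < tv)
    (hpos : 0 < a * tu + b * tv) (hT : a * tu + b * tv ≤ T) :
    ‖a • p + b • q‖ ^ 2 / T ≤ a * (‖p‖ ^ 2 / tu) + b * (‖q‖ ^ 2 / tv) := by
  have e1 : ‖a • p + b • q‖ ^ 2 = a ^ 2 * ‖p‖ ^ 2 + 2 * a * b * ⟪p, q⟫ + b ^ 2 * ‖q‖ ^ 2 := by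
    rw [norm_add_sq_real, norm_smul, norm_smul, real_inner_smul_left, real_inner_smul_right, mul_pow, mul_pow,
      Real.norm_eq_abs, Real.norm_eq_abs, sq_abs, sq_abs]; ring
  have e2 : ‖tv • p - tu • q‖ ^ 2 = tv ^ 2 * ‖p‖ ^ 2 - 2 * tu * tv * ⟪p, q⟫ + tu ^ 2 * ‖q‖ ^ 2 := by
    rw [norm_sub_sq_real, norm_smul, norm_smul, real_inner_smul_left, real_inner_smul_right, mul_pow, mul_pow,
      Real.norm_eq_abs, Real.norm_eq_abs, sq_abs, sq_abs]; ring
  have hnn : 0 ≤ a * b * (tv ^ 2 * ‖p‖ ^ 2 - 2 * tu * tv * ⟪p, q⟫ + tu ^ 2 * ‖q‖ ^ 2) := by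
    rw [← e2]; exact mul_nonneg (mul_nonneg ha hb) (sq_nonneg _)
  have hcoef : 0 ≤ a * (‖p‖ ^ 2 / tu) + b * (‖q‖ ^ 2 / tv) := by positivity
  have hT0 : 0 < T := lt_of_lt_of_le hpos hT
  rw [div_le_iff₀ hT0]
  calc ‖a • p + b • q‖ ^ 2 ≤ (a * (‖p‖ ^ 2 / tu) + b * (‖q‖ ^ 2 / tv)) * (a * tu + b * tv) := by
        have : (a * (‖p‖ ^ 2 / tu) + b * (‖q‖ ^ 2 / tv)) * (a * tu + b * tv)
            = a ^ 2 * ‖p‖ ^ 2 + 2 * a * b * ⟪p, q⟫ + b ^ 2 * ‖q‖ ^ 2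
              + a * b * (tv ^ 2 * ‖p‖ ^ 2 - 2 * tu * tv * ⟪p, q⟫ + tu ^ 2 * ‖q‖ ^ 2) / (tu * tv) := by
          field_simp
          ring
        rw [e1, this]
        have := div_nonneg hnn (mul_pos htu htv).le
        linarith
    _ ≤ (a * (‖p‖ ^ 2 / tu) + b * (‖q‖ ^ 2 / tv)) * T := mul_le_mul_of_nonneg_left hT hcoef

/-- Convexity of the squared norm along a segment: `‖a u + b v‖² ≤ a ‖u‖² + b ‖v‖²` for `a + b = 1`, `a, b ≥ 0`. [folklore] -/
theorem norm_sq_combo_le (u v : ℍ) {a b : ℝ} (ha : 0 ≤ a) (hb : 0 ≤ b) (hab : a + b = 1) :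
    ‖a • u + b • v‖ ^ 2 ≤ a * ‖u‖ ^ 2 + b * ‖v‖ ^ 2 := by
  have e1 : ‖a • u + b • v‖ ^ 2 = a ^ 2 * ‖u‖ ^ 2 + 2 * a * b * ⟪u, v⟫ + b ^ 2 * ‖v‖ ^ 2 := by
    rw [norm_add_sq_real, norm_smul, norm_smul, real_inner_smul_left, real_inner_smul_right, mul_pow, mul_pow,
      Real.norm_eq_abs, Real.norm_eq_abs, sq_abs, sq_abs]; ring
  have e3 : ‖u - v‖ ^ 2 = ‖u‖ ^ 2 - 2 * ⟪u, v⟫ + ‖v‖ ^ 2 := norm_sub_sq_real u v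
  have hnn : 0 ≤ a * b * (‖u‖ ^ 2 - 2 * ⟪u, v⟫ + ‖v‖ ^ 2) := by
    rw [← e3]; exact mul_nonneg (mul_nonneg ha hb) (sq_nonneg _)
  have hb' : b = 1 - a := by linarith
  rw [e1]
  rw [hb'] at hnn ⊢
  nlinarith [hnn]

/-- CONVEXITY OF THE DEFECT: for every `x`, `w ↦ G_w(x)` is convex on the imaginary ball of radius `π` (termwise, by the
two-point inequality applied to the Mittag-Leffler form). [folklore] -/
theorem convexOn_G (x : ℍ) : ConvexOn ℝ imBall (fun w => G w x) := by
  refine ⟨convex_imBall, fun u hu v hv a b ha hb hab => ?_⟩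
  have hm : a • u + b • v ∈ imBall := convex_imBall hu hv ha hb hab
  have hGu := hasSum_G hu.1 hu.2 x
  have hGv := hasSum_G hv.1 hv.2 x
  have hGm := hasSum_G hm.1 hm.2 x
  have hsum := (hGu.mul_left a).add (hGv.mul_left b)
  simp only [smul_eq_mul]
  refine hasSum_le (fun n => ?_) hGm hsum
  -- the `n`-th term
  have hpi := Real.pi_pos
  set R : ℝ := ((n : ℝ) + 1) ^ 2 * Real.pi ^ 2 with hR
  have hRπ : Real.pi ^ 2 ≤ R := by
    have : (1 : ℝ) ≤ ((n : ℝ) + 1) ^ 2 := by nlinarith [(Nat.cast_nonneg n : (0 : ℝ) ≤ n)]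
    nlinarith
  have htu : 0 < R - ‖u‖ ^ 2 := by
    have : ‖u‖ ^ 2 < Real.pi ^ 2 := by nlinarith [hu.2, norm_nonneg u]
    linarith
  have htv : 0 < R - ‖v‖ ^ 2 := by
    have : ‖v‖ ^ 2 < Real.pi ^ 2 := by nlinarith [hv.2, norm_nonneg v]
    linarith
  have hpos : 0 < a * (R - ‖u‖ ^ 2) + b * (R - ‖v‖ ^ 2) := by
    nlinarith [min_le_left (R - ‖u‖ ^ 2) (R - ‖v‖ ^ 2), min_le_right (R - ‖u‖ ^ 2) (R - ‖v‖ ^ 2), lt_min htu htv]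
  have hT : a * (R - ‖u‖ ^ 2) + b * (R - ‖v‖ ^ 2) ≤ R - ‖a • u + b • v‖ ^ 2 := by
    have := norm_sq_combo_le u v ha hb hab
    nlinarith
  have hA : Aop x (a • u + b • v) = a • Aop x u + b • Aop x v := by
    rw [map_add, map_smul, map_smul]
  have key := norm_sq_combo_div_le (Aop x u) (Aop x v) ha hb htu htv hpos hT
  rw [← hA] at key
  have e : ∀ (y : ℍ) (t : ℝ), 2 * ‖Aop x y‖ ^ 2 / t = 2 * (‖Aop x y‖ ^ 2 / t) := fun y t => by ring
  rw [e, e, e]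
  linarith

/-- Convex combinations with total weight `≤ 1` stay in `imBall` (pad with the point `0`). [folklore] -/
theorem sum_smul_mem_imBall {ι : Type*} [Fintype ι] {Z : ι → ℍ} {c : ι → ℝ} (hZ : ∀ i, Z i ∈ imBall) (hc : ∀ i, 0 ≤ c i)
    (hs : ∑ i, c i ≤ 1) : ∑ i, c i • Z i ∈ imBall := by
  let wt : Option ι → ℝ := fun o => o.elim (1 - ∑ i, c i) c
  let pt : Option ι → ℍ := fun o => o.elim 0 Z
  have h := convex_imBall.sum_mem (t := Finset.univ) (w := wt) (z := pt)
    (fun o _ => by cases o <;> simp [wt, hc, hs]) (by simp [wt]) (fun o _ => by cases o <;> simp [pt, hZ, zero_mem_imBall])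
  simpa [wt, pt] using h

/-- JENSEN FOR THE DEFECT: `G_{Σ c_i Z_i}(x) ≤ Σ c_i G_{Z_i}(x)` for `Z_i ∈ imBall`, `c_i ≥ 0`, `Σ c_i ≤ 1` (pad with `Z = 0`,
where `G_0 = 0`). [folklore] -/
theorem G_sum_le {ι : Type*} [Fintype ι] {Z : ι → ℍ} {c : ι → ℝ} (hZ : ∀ i, Z i ∈ imBall) (hc : ∀ i, 0 ≤ c i)
    (hs : ∑ i, c i ≤ 1) (x : ℍ) : G (∑ i, c i • Z i) x ≤ ∑ i, c i * G (Z i) x := by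
  let wt : Option ι → ℝ := fun o => o.elim (1 - ∑ i, c i) c
  let pt : Option ι → ℍ := fun o => o.elim 0 Z
  have h := (convexOn_G x).map_sum_le (t := Finset.univ) (w := wt) (p := pt)
    (fun o _ => by cases o <;> simp [wt, hc, hs]) (by simp [wt]) (fun o _ => by cases o <;> simp [pt, hZ, zero_mem_imBall])
  simpa [wt, pt] using h

end Convexity

/-! ## 4. The fibre map `k(u) = exp(Σ_i c_i • qlog(a_i ū)) · u` and injectivity of its tangent differential -/

section Fibre

variable {ι : Type*} [Fintype ι]

/-- The continuous real-linear map `u ↦ a ū`. [folklore] -/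
def mulStarCLM (a : ℍ) : ℍ →L[ℝ] ℍ :=
  LinearMap.toContinuousLinearMap
    { toFun := fun u => a * star u
      map_add' := fun u v => by rw [star_add, mul_add]
      map_smul' := fun r u => by
        rw [RingHom.id_apply, show star (r • u) = r • star u by ext <;> simp, mul_smul_comm] }

/-- Evaluation of `mulStarCLM`. [folklore] -/
@[simp] theorem mulStarCLM_apply (a u : ℍ) : mulStarCLM a u = a * star u := rfl

/-- The EXPONENT of the fibre map: `Y(u) := Σ_i c_i • qlog (a_i ū)`. [folklore] -/
def Yf (a : ι → ℍ) (c : ι → ℝ) (u : ℍ) : ℍ := ∑ i, c i • qlog (a i * star u)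

/-- The FIBRE MAP (one-variable law of the exp-mean-log average in the quaternion model): `k(u) := exp(Y(u)) · u`. [folklore] -/
def kf (a : ι → ℍ) (c : ι → ℝ) (u : ℍ) : ℍ := exp (Yf a c u) * u

/-- The derivative of the exponent: `Y′(u) = Σ_i c_i • D qlog(a_i ū) ∘ (v ↦ a_i v̄)`. [folklore] -/
def YD (a : ι → ℍ) (c : ι → ℝ) (u : ℍ) : ℍ →L[ℝ] ℍ :=
  ∑ i, c i • (fderiv ℝ qlog (a i * star u)).comp (mulStarCLM (a i))

/-- Evaluation of `YD`. [folklore] -/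
theorem YD_apply (a : ι → ℍ) (c : ι → ℝ) (u v : ℍ) :
    YD a c u v = ∑ i, c i • fderiv ℝ qlog (a i * star u) (a i * star v) := by
  simp [YD]

/-- The derivative of the fibre map: `k′(u) v = exp(Y u) v + D exp(Y u) (Y′(u) v) · u`. [folklore] -/
def kD (a : ι → ℍ) (c : ι → ℝ) (u : ℍ) : ℍ →L[ℝ] ℍ :=
  exp (Yf a c u) • ContinuousLinearMap.id ℝ ℍ + MulOpposite.op u • (fderiv ℝ exp (Yf a c u)).comp (YD a c u)

/-- Evaluation of `kD`. [folklore] -/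
theorem kD_apply (a : ι → ℍ) (c : ι → ℝ) (u v : ℍ) :
    kD a c u v = exp (Yf a c u) * v + fderiv ℝ exp (Yf a c u) (YD a c u v) * u := by
  simp [kD, MulOpposite.smul_eq_mul_unop]

/-- STRICT DIFFERENTIABILITY of the exponent on the guard domain `‖a_i ū − 1‖ < 1`. [folklore] -/
theorem hasStrictFDerivAt_Yf {a : ι → ℍ} (c : ι → ℝ) {u : ℍ} (hg : ∀ i, ‖a i * star u - 1‖ < 1) :
    HasStrictFDerivAt (Yf a c) (YD a c u) u := by
  unfold Yf YD
  apply HasStrictFDerivAt.fun_sum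
  intro i _
  have h1 : HasStrictFDerivAt qlog (fderiv ℝ qlog (a i * star u)) (a i * star u) :=
    (contDiffAt_qlog (hg i) (n := 1)).hasStrictFDerivAt one_ne_zero
  have h2 : HasStrictFDerivAt (fun y : ℍ => a i * star y) (mulStarCLM (a i)) u := (mulStarCLM (a i)).hasStrictFDerivAt
  exact (h1.comp u h2).const_smul (c i)

/-- STRICT DIFFERENTIABILITY OF THE FIBRE MAP with derivative `kD` on the guard domain. [folklore] -/
theorem hasStrictFDerivAt_kf {a : ι → ℍ} (c : ι → ℝ) {u : ℍ} (hg : ∀ i, ‖a i * star u - 1‖ < 1) :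
    HasStrictFDerivAt (kf a c) (kD a c u) u := by
  have hE : HasStrictFDerivAt (exp : ℍ → ℍ) (fderiv ℝ exp (Yf a c u)) (Yf a c u) :=
    ((NormedSpace.exp_analytic (𝕂 := ℝ) (Yf a c u)).contDiffAt (n := 1)).hasStrictFDerivAt one_ne_zero
  have h := (hE.comp u (hasStrictFDerivAt_Yf c hg)).fun_mul' (hasStrictFDerivAt_id u)
  exact h

/-- Real parts: `re (ū v) = ⟪u, v⟫`. [folklore] -/
theorem star_mul_re (u v : ℍ) : (star u * v).re = ⟪u, v⟫ := by
  rw [Quaternion.inner_def]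
  simp [Quaternion.re_star]

/-- TANGENT INJECTIVITY OF THE FIBRE MAP.  For a unit `u`, unit `a_i` with `‖a_i ū − 1‖ < 1/2`, weights `c_i ≥ 0` with
`Σ c_i < 1`: `k′(u) v = 0` with `v ⊥ u` forces `v = 0`.  Proof: with `x = ū v` (imaginary), `X = u x ū`, `W_i = a_i ū`,
`Z_i = qlog W_i`, `Y = Σ c_i Z_i`, the equation reads `D exp(Y)(N_Y X) = D exp(Y)(Σ c_i N_{Z_i} X)` (key identity of leaf A at `Y`
and at each `Z_i`), `D exp(Y)` is injective (`‖Y‖ < 1 < π`), and pairing `N_Y X = Σ c_i N_{Z_i} X` with `X` gives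
`(1 − Σ c_i) ‖X‖² = G_Y(X) − Σ c_i G_{Z_i}(X) ≤ 0` by Jensen. [folklore] -/
theorem kD_tangent_injective {a : ι → ℍ} {c : ι → ℝ} {u : ℍ} (hu : ‖u‖ = 1) (ha : ∀ i, ‖a i‖ = 1)
    (hc : ∀ i, 0 ≤ c i) (hs : ∑ i, c i < 1) (hg : ∀ i, ‖a i * star u - 1‖ < 1 / 2) :
    ∀ v, ⟪u, v⟫ = 0 → kD a c u v = 0 → v = 0 := by
  intro v huv hkv
  set x : ℍ := star u * v with hx_def
  set X : ℍ := u * x * star u with hX_def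
  have hY_def : Yf a c u = ∑ i, c i • qlog (a i * star u) := rfl
  -- unit algebra
  have hune : u ≠ 0 := by intro h; rw [h, norm_zero] at hu; exact zero_ne_one hu
  have hsu : star u * u = 1 := by
    rw [Quaternion.star_mul_self, Quaternion.normSq_eq_norm_mul_self, hu]; simp
  have hus : u * star u = 1 := by
    rw [Quaternion.self_mul_star, Quaternion.normSq_eq_norm_mul_self, hu]; simp
  have hv : v = u * x := by rw [hx_def, ← mul_assoc, hus, one_mul]
  have hxre : x.re = 0 := by rw [hx_def, star_mul_re, huv]
  have hXre : X.re = 0 := by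
    apply Quaternion.star_eq_neg.1
    rw [hX_def, star_mul, star_mul, star_star, Quaternion.star_eq_neg.2 hxre]
    simp [mul_assoc]
  have hXu : X * u = u * x := by rw [hX_def, mul_assoc, hsu, mul_one]
  -- the points `W_i = a_i ū`, `Z_i = qlog W_i`, `Y = Σ c_i Z_i`
  have hW1 : ∀ i, ‖a i * star u‖ = 1 := fun i => by simp [norm_mul, ha i, hu]
  have hg1 : ∀ i, ‖a i * star u - 1‖ < 1 := fun i => (hg i).trans (by norm_num)
  have hZmem : ∀ i, qlog (a i * star u) ∈ imBall := fun i =>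
    ⟨qlog_re_of_norm_eq_one (hW1 i) (hg1 i), (norm_qlog_lt_one (hg i)).trans (by linarith [Real.pi_gt_three])⟩
  have hYmem : Yf a c u ∈ imBall := by
    rw [hY_def]; exact sum_smul_mem_imBall (Z := fun i => qlog (a i * star u)) hZmem hc hs.le
  -- the derivative of the exponent on `v`
  have hYD : YD a c u v = -∑ i, c i • N (qlog (a i * star u)) X := by
    rw [YD_apply, ← Finset.sum_neg_distrib]
    refine Finset.sum_congr rfl fun i _ => ?_
    have h1 : a i * star v = -(a i * star u * X) := by
      have : a i * star u * X = a i * x * star u := by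
        rw [hX_def, show a i * star u * (u * x * star u) = a i * (star u * u) * x * star u by simp only [mul_assoc],
          hsu, mul_one]
      rw [this, hv, star_mul, Quaternion.star_eq_neg.2 hxre]
      simp [mul_assoc]
    rw [h1, map_neg, smul_neg, fderiv_qlog_apply_mul (hW1 i) (hg i) hXre]
  -- `kD v = 0` says `D exp(Y) (N_Y X − Σ c_i N_{Z_i} X) · u = 0`
  have hkey : fderiv ℝ exp (Yf a c u) (N (Yf a c u) X) = exp (Yf a c u) * X :=
    fderiv_exp_apply_N hYmem.1 hYmem.2 hXre
  have hE0 : fderiv ℝ exp (Yf a c u) (N (Yf a c u) X - ∑ i, c i • N (qlog (a i * star u)) X) = 0 := by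
    have h0 : fderiv ℝ exp (Yf a c u) (N (Yf a c u) X - ∑ i, c i • N (qlog (a i * star u)) X) * u = 0 := by
      rw [map_sub, sub_mul, hkey, mul_assoc, hXu, ← hv]
      have h := hkv
      rw [kD_apply, hYD, map_neg, neg_mul, ← sub_eq_add_neg] at h
      exact h
    rcases mul_eq_zero.1 h0 with h | h
    · exact h
    · exact absurd h hune
  have hN : N (Yf a c u) X = ∑ i, c i • N (qlog (a i * star u)) X :=
    sub_eq_zero.1 (fderiv_exp_injective_of_re_eq_zero hYmem.1 hYmem.2 (by rw [hE0, map_zero]))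
  -- pair with `X`: `(1 − Σ c_i) ‖X‖² = G_Y X − Σ c_i G_{Z_i} X ≤ 0`
  have hinner : ‖X‖ ^ 2 - G (Yf a c u) X = ∑ i, c i * (‖X‖ ^ 2 - G (qlog (a i * star u)) X) := by
    have h := congrArg (fun q : ℍ => ⟪q, X⟫) hN
    simp only [sum_inner, real_inner_smul_left] at h
    rw [inner_N_self_eq hYmem.1 hXre] at h
    rw [h]
    exact Finset.sum_congr rfl fun i _ => by rw [inner_N_self_eq (hZmem i).1 hXre]
  have hJ : G (Yf a c u) X ≤ ∑ i, c i * G (qlog (a i * star u)) X := by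
    rw [hY_def]; exact G_sum_le (Z := fun i => qlog (a i * star u)) hZmem hc hs.le X
  have hX0 : X = 0 := by
    have hsplit : ∑ i, c i * (‖X‖ ^ 2 - G (qlog (a i * star u)) X)
        = (∑ i, c i) * ‖X‖ ^ 2 - ∑ i, c i * G (qlog (a i * star u)) X := by
      rw [Finset.sum_mul, ← Finset.sum_sub_distrib]
      exact Finset.sum_congr rfl fun i _ => by ring
    have h1 : (1 - ∑ i, c i) * ‖X‖ ^ 2 ≤ 0 := by nlinarith [hinner, hJ, hsplit]
    have h2 : ‖X‖ ^ 2 ≤ 0 := by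
      by_contra h
      exact absurd h1 (not_le.2 (mul_pos (by linarith) (not_le.1 h)))
    have h3 : ‖X‖ = 0 := by nlinarith [norm_nonneg X]
    exact norm_eq_zero.1 h3
  -- conclude
  have hx0 : x = 0 := by
    calc x = star u * u * x * (star u * u) := by rw [hsu, one_mul, mul_one]
      _ = star u * X * u := by simp only [hX_def, mul_assoc]
      _ = 0 := by rw [hX0, mul_zero, zero_mul]
  rw [hv, hx0, mul_zero]

end Fibre


/-! ## 5. The corollary on `SU(2)`: absolute continuity of the restricted Haar push-forward under the fibre law -/

section SU2

open scoped Matrix.Norms.L2Operator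

attribute [local instance] Literature.Analysis.FluidPDE.Tao2016.quatMeasurableSpace
attribute [local instance] Literature.MathematicalPhysics.QuantumLattice.secondCountableTopology_su2

variable {ι : Type*} [Fintype ι]

/-- Dictionary: `↑(h) * star ↑(quatToSU2 u) = quatMatrix (su2Quat h * star u)` for a unit quaternion `u`. [folklore] -/
theorem coe_mul_star_coe_quatToSU2 (h : Matrix.specialUnitaryGroup (Fin 2) ℂ) {u : ℍ} (hu : ‖u‖ = 1) :
    (h : Matrix (Fin 2) (Fin 2) ℂ) * star (quatToSU2 u : Matrix (Fin 2) (Fin 2) ℂ) = quatMatrix (su2Quat h * star u) := by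
  rw [quatMatrix_mul, quatMatrix_su2Quat, quatMatrix_star, coe_quatToSU2_of_norm_eq_one hu, Matrix.star_eq_conjTranspose]

/-- MAIN COROLLARY (the (K4) assembly input for the exp-mean-log fibre law).  Let `S ⊆ SU(2)` be open, `h_i ∈ SU(2)`, weights
`c_i ≥ 0` with `Σ c_i < 1`, and `K : SU(2) → SU(2)` measurable with, for `W ∈ S`, the guard `‖h_i W* − 1‖ < 1/2` (`L²`-operator norm)
and `↑(K W) = exp (Σ_i c_i • mlog (h_i W*)) · W` (series logarithm `MatrixLog.mlog`).  Then `((Haar).restrict S).map K ≪ Haar`.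
(Engine `T4HaarSU2LocalDiffeo.haar_restrict_map_absolutelyContinuous` with `k = kf`, `k′ = kD`, §4.) [folklore] -/
theorem haar_restrict_map_absolutelyContinuous_expMeanLog {S : Set (Matrix.specialUnitaryGroup (Fin 2) ℂ)} (hS : IsOpen S)
    (h : ι → Matrix.specialUnitaryGroup (Fin 2) ℂ) {c : ι → ℝ} (hc : ∀ i, 0 ≤ c i) (hs : ∑ i, c i < 1)
    {K : Matrix.specialUnitaryGroup (Fin 2) ℂ → Matrix.specialUnitaryGroup (Fin 2) ℂ} (hK : Measurable K)
    (hg : ∀ W ∈ S, ∀ i, ‖(h i : Matrix (Fin 2) (Fin 2) ℂ) * star (W : Matrix (Fin 2) (Fin 2) ℂ) - 1‖ < 1 / 2)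
    (hKW : ∀ W ∈ S, (K W : Matrix (Fin 2) (Fin 2) ℂ) =
      NormedSpace.exp (∑ i, (c i : ℂ) • MatrixLog.mlog ((h i : Matrix (Fin 2) (Fin 2) ℂ) * star (W : Matrix (Fin 2) (Fin 2) ℂ)))
        * (W : Matrix (Fin 2) (Fin 2) ℂ)) :
    ((haarProbability (Matrix.specialUnitaryGroup (Fin 2) ℂ)).restrict S).map K ≪
      haarProbability (Matrix.specialUnitaryGroup (Fin 2) ℂ) := by
  set a : ι → ℍ := fun i => su2Quat (h i) with ha_def
  have ha : ∀ i, ‖a i‖ = 1 := fun i => norm_su2Quat (h i)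
  -- the guard in the quaternion model
  have hgq : ∀ u : ℍ, ‖u‖ = 1 → quatToSU2 u ∈ S → ∀ i, ‖a i * star u - 1‖ < 1 / 2 := by
    intro u hu huS i
    have := hg _ huS i
    rwa [coe_mul_star_coe_quatToSU2 (h i) hu, norm_quatMatrix_sub_one] at this
  refine haar_restrict_map_absolutelyContinuous hS hK (k := kf a c) (k' := kD a c)
    (fun u hu huS => hasStrictFDerivAt_kf c fun i => (hgq u hu huS i).trans (by norm_num))
    (fun u hu huS => ?_) (fun u hu huS => kD_tangent_injective hu ha hc hs (hgq u hu huS))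
  -- agreement with `K`
  symm
  apply su2Quat_eq_of_coe_eq
  rw [hKW _ huS, kf, quatMatrix_mul, quatMatrix_exp, ← coe_quatToSU2_of_norm_eq_one hu]
  congr 2
  rw [Yf, quatMatrix_sum]
  refine Finset.sum_congr rfl fun i _ => ?_
  rw [quatMatrix_smul, quatMatrix_qlog ((hgq u hu huS i).trans (by norm_num)), coe_mul_star_coe_quatToSU2 (h i) hu]

/-- The same for the cell's `HaarData.haar` on `SU(2)` (definitionally `haarProbability`). [folklore] -/
theorem haarData_restrict_map_absolutelyContinuous_expMeanLog {S : Set (Matrix.specialUnitaryGroup (Fin 2) ℂ)} (hS : IsOpen S)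
    (h : ι → Matrix.specialUnitaryGroup (Fin 2) ℂ) {c : ι → ℝ} (hc : ∀ i, 0 ≤ c i) (hs : ∑ i, c i < 1)
    {K : Matrix.specialUnitaryGroup (Fin 2) ℂ → Matrix.specialUnitaryGroup (Fin 2) ℂ} (hK : Measurable K)
    (hg : ∀ W ∈ S, ∀ i, ‖(h i : Matrix (Fin 2) (Fin 2) ℂ) * star (W : Matrix (Fin 2) (Fin 2) ℂ) - 1‖ < 1 / 2)
    (hKW : ∀ W ∈ S, (K W : Matrix (Fin 2) (Fin 2) ℂ) =
      NormedSpace.exp (∑ i, (c i : ℂ) • MatrixLog.mlog ((h i : Matrix (Fin 2) (Fin 2) ℂ) * star (W : Matrix (Fin 2) (Fin 2) ℂ)))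
        * (W : Matrix (Fin 2) (Fin 2) ℂ)) :
    ((HaarData.haar : Measure (Matrix.specialUnitaryGroup (Fin 2) ℂ)).restrict S).map K ≪ HaarData.haar :=
  haar_restrict_map_absolutelyContinuous_expMeanLog hS h hc hs hK hg hKW

end SU2


end Literature.MathematicalPhysics.QuantumFieldTheory.Balaban1983to89.T4EMLFibreAC

end
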